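import Literature.NumberTheory.Transcendental.KZFibredRelations
import Literature.NumberTheory.Transcendental.KZDominatedFamily
import Literature.NumberTheory.Transcendental.KZLogCalculusProofs
import Summits.KontsevichZagierPeriods.KontsevichZagierPeriods.Theses.ValuedFieldSpecialisation
import Summits.KontsevichZagierPeriods.KontsevichZagierPeriods.Theorems.ValuedFieldSpecialisationParametricLiftingStrength

/-!
# Route ValuedFieldSpecialisation — crux `ParametricLifting` (stmt-KontsevichZagierPeriods-3498):
THE FRULLANI SECTOR — a positive end-to-end instance of the regularised lifting mechanism

SKELETON (lead c6). The crux `ParametricLifting` (PL) asks, for rational representations `r`, `r'`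
with equal value, for a net `G = Σ mᵢ [Rᵢ] ∈ KZ.fibredRelations` of DOMINATED families whose special
fibres satisfy `Σ mᵢ [r₀ᵢ] − ([r] − [r']) ∈ KZ.relations`, divergent intermediates being allowed
inside `G`. This file exhibits the mechanism ONCE, positively, on the simplest genuine
regularisation, Frullani's: with `φ(t) = 1/(1+t)`,

  `r  = ((0,1],  (φ t − φ (2t)) / t) = ((0,1], 1/((1+t)(1+2t)))`,
  `r' = ([1,2],  (φ 0 − φ v) / v)    = ([1,2], 1/(1+v))`        (both of value `log 3 − log 2`).

Families over the parameter `s = z 0 ∈ (0, 1/2)` (base `G = {0 < y 0, 2 y 0 < 1}`), fibre variable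
`t = z 1`, all domains bands `KZlog.band G a b = {s ∈ G, a s ≤ t ≤ b s}`:

* `R₁ = ({s ≤ t ≤ 1}, 1/((1+t)(1+2t))) → r` (dominated by `r`);
* REGULARISED LINEARITY `[A] − [R₁] − [B] ∈ integrandAddRel`, `A = ({s ≤ t ≤ 1}, 1/(t(1+t)))`,
  `B = ({s ≤ t ≤ 1}, 1/(t(1+2t)))` — illegal at `s = 0` (neither piece is integrable on `(0,1]`),
  legal as families, whose slice values diverge like `log (1/s)`;
* the fibred dilation `t ↦ 2t`: `[B] − [B'] ∈ fibredRelations`, `B' = ({2s ≤ u ≤ 2}, 1/(u(1+u)))`;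
* fibre splits at `t = 2s` and `u = 1`: `[A] − [K] − [M]`, `[B'] − [M] − [N] ∈ fibredRelations`, with
  `K = ({s ≤ t ≤ 2s}, 1/(t(1+t)))` carrying the ESCAPING MASS `log 2` and `N = ({1 ≤ u ≤ 2}, 1/(u(1+u)))`
  a constant family `→ n₀ = ([1,2], 1/(u(1+u)))`;
* the fibred blow-up `t = s v`: `[D] − [K] ∈ fibredRelations`, `D = ({1 ≤ v ≤ 2}, 1/(v(1+sv))) → d₀ = ([1,2], 1/v)`
  (dominated by `d₀`);
* net `G = [R₁] − [D] + [N] ∈ fibredRelations` (three dominated families), special-fibre relation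
  `[d₀] − [r'] − [n₀] ∈ integrandAddRel` (`1/v = 1/(1+v) + 1/(v(1+v))`).

Sources: M. Kontsevich, D. Zagier, *Periods* (2001), §1.2 (rules (1),(2)); G. Boros, V. Moll,
*Irresistible Integrals* (2004), §5.6 (Frullani). No new definitions.
-/

noncomputable section

namespace Summit.KontsevichZagierPeriods.ValuedFieldSpecialisation

open MeasureTheory Set Filter
open scoped Topology
open Literature.NumberTheory.Transcendental Literature.NumberTheory.Transcendental.KZ
open Literature.ModelTheory.ExponentialFields (IsSemialgebraic)

/-! ### Stubs (registered `--supports` sub-goals of crux 3498, line `registered`, lead c6) -/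

/-- **Stub A (the big band).** The family `A₂ = ({0 < s, 2s < 1, s ≤ t ≤ 2}, 1/(t(1+t)))` is an
integral representation (integrable: fibre integrals `≤ log 2 − log s`, integrable in `s`).
[Kontsevich–Zagier 2001, §1.1] [folklore] -/
theorem frullani_exists_bigRep :
    ∃ A₂ : KZ.IntegralRep (1 + 1), A₂.domain = KZlog.band {y : Fin 1 → ℝ | 0 < y 0 ∧ 2 * y 0 < 1} (fun y => y 0) (fun _ => 2) ∧ A₂.integrand = fun z => (z 1 * (1 + z 1))⁻¹ := by
  sorry

/-- **Stub B (regularised linearity).** Over `{s ≤ t ≤ 1}`: `1/(t(1+t)) = 1/((1+t)(1+2t)) + 1/(t(1+2t))`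
as an instance of integrand additivity among FAMILIES. [Kontsevich–Zagier 2001, §1.2 rule (1)] [folklore] -/
theorem frullani_exists_linearity :
    ∀ (A : KZ.IntegralRep (1 + 1)), A.domain = KZlog.band {y : Fin 1 → ℝ | 0 < y 0 ∧ 2 * y 0 < 1} (fun y => y 0) (fun _ => 1) → (A.integrand = fun z => (z 1 * (1 + z 1))⁻¹) → ∃ R₁ B : KZ.IntegralRep (1 + 1), R₁.domain = KZlog.band {y : Fin 1 → ℝ | 0 < y 0 ∧ 2 * y 0 < 1} (fun y => y 0) (fun _ => 1) ∧ (R₁.integrand = fun z => ((1 + z 1) * (1 + 2 * z 1))⁻¹) ∧ B.domain = KZlog.band {y : Fin 1 → ℝ | 0 < y 0 ∧ 2 * y 0 < 1} (fun y => y 0) (fun _ => 1) ∧ (B.integrand = fun z => (z 1 * (1 + 2 * z 1))⁻¹) ∧ KZ.of A - KZ.of R₁ - KZ.of B ∈ KZ.integrandAddRel := by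
  sorry

/-- **Stub C (the fibred dilation `t ↦ 2t`).** [Kontsevich–Zagier 2001, §1.2 rule (2)] [folklore] -/
theorem frullani_dilation :
    ∀ (B B' : KZ.IntegralRep (1 + 1)), B.domain = KZlog.band {y : Fin 1 → ℝ | 0 < y 0 ∧ 2 * y 0 < 1} (fun y => y 0) (fun _ => 1) → (B.integrand = fun z => (z 1 * (1 + 2 * z 1))⁻¹) → B'.domain = KZlog.band {y : Fin 1 → ℝ | 0 < y 0 ∧ 2 * y 0 < 1} (fun y => 2 * y 0) (fun _ => 2) → (B'.integrand = fun z => (z 1 * (1 + z 1))⁻¹) → KZ.of B - KZ.of B' ∈ KZ.fibredRelations := by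
  sorry

/-- **Stub D (the fibre splits at `t = 2s` and `u = 1`).** [Kontsevich–Zagier 2001, §1.2 rule (1)] [folklore] -/
theorem frullani_splits :
    ∀ (A₂ : KZ.IntegralRep (1 + 1)), A₂.domain = KZlog.band {y : Fin 1 → ℝ | 0 < y 0 ∧ 2 * y 0 < 1} (fun y => y 0) (fun _ => 2) → (A₂.integrand = fun z => (z 1 * (1 + z 1))⁻¹) → ∃ A B' K M N : KZ.IntegralRep (1 + 1), A.domain = KZlog.band {y : Fin 1 → ℝ | 0 < y 0 ∧ 2 * y 0 < 1} (fun y => y 0) (fun _ => 1) ∧ (A.integrand = fun z => (z 1 * (1 + z 1))⁻¹) ∧ B'.domain = KZlog.band {y : Fin 1 → ℝ | 0 < y 0 ∧ 2 * y 0 < 1} (fun y => 2 * y 0) (fun _ => 2) ∧ (B'.integrand = fun z => (z 1 * (1 + z 1))⁻¹) ∧ K.domain = KZlog.band {y : Fin 1 → ℝ | 0 < y 0 ∧ 2 * y 0 < 1} (fun y => y 0) (fun y => 2 * y 0) ∧ (K.integrand = fun z => (z 1 * (1 + z 1))⁻¹) ∧ M.domain = KZlog.band {y : Fin 1 → ℝ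 | 0 < y 0 ∧ 2 * y 0 < 1} (fun y => 2 * y 0) (fun _ => 1) ∧ (M.integrand = fun z => (z 1 * (1 + z 1))⁻¹) ∧ N.domain = KZlog.band {y : Fin 1 → ℝ | 0 < y 0 ∧ 2 * y 0 < 1} (fun _ => 1) (fun _ => 2) ∧ (N.integrand = fun z => (z 1 * (1 + z 1))⁻¹) ∧ KZ.of A - KZ.of K - KZ.of M ∈ KZ.fibredRelations ∧ KZ.of B' - KZ.of M - KZ.of N ∈ KZ.fibredRelations := by
  sorry

/-- **Stub E (the fibred blow-up `t = s v` captures the escaping mass).**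
[Kontsevich–Zagier 2001, §1.2 rule (2)] [folklore] -/
theorem frullani_blowup :
    ∀ (K : KZ.IntegralRep (1 + 1)), K.domain = KZlog.band {y : Fin 1 → ℝ | 0 < y 0 ∧ 2 * y 0 < 1} (fun y => y 0) (fun y => 2 * y 0) → (K.integrand = fun z => (z 1 * (1 + z 1))⁻¹) → ∃ D : KZ.IntegralRep (1 + 1), D.domain = KZlog.band {y : Fin 1 → ℝ | 0 < y 0 ∧ 2 * y 0 < 1} (fun _ => 1) (fun _ => 2) ∧ (∀ z ∈ D.domain, D.integrand z = (z 1 * (1 + z 0 * z 1))⁻¹) ∧ KZ.of D - KZ.of K ∈ KZ.fibredRelations := by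
  sorry

/-- **Stub F₁ (the truncated family is dominated by its special fibre `r`).** [folklore] -/
theorem frullani_dominated_R :
    ∀ (R₁ : KZ.IntegralRep (1 + 1)), R₁.domain = KZlog.band {y : Fin 1 → ℝ | 0 < y 0 ∧ 2 * y 0 < 1} (fun y => y 0) (fun _ => 1) → (R₁.integrand = fun z => ((1 + z 1) * (1 + 2 * z 1))⁻¹) → ∃ r : KZ.IntegralRep 1, r.domain = {x | 0 < x 0 ∧ x 0 ≤ 1} ∧ (r.integrand = fun x => ((1 + x 0) * (1 + 2 * x 0))⁻¹) ∧ r.IsRational ∧ KZ.IsDominatedFamily R₁ r r := by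
  sorry

/-- **Stub F₂ (the blown-up family is dominated, special fibre `d₀ = ([1,2], 1/v)`).** [folklore] -/
theorem frullani_dominated_D :
    ∀ (D : KZ.IntegralRep (1 + 1)), D.domain = KZlog.band {y : Fin 1 → ℝ | 0 < y 0 ∧ 2 * y 0 < 1} (fun _ => 1) (fun _ => 2) → (∀ z ∈ D.domain, D.integrand z = (z 1 * (1 + z 0 * z 1))⁻¹) → ∃ d₀ : KZ.IntegralRep 1, d₀.domain = {x | 1 ≤ x 0 ∧ x 0 ≤ 2} ∧ (d₀.integrand = fun x => (x 0)⁻¹) ∧ KZ.IsDominatedFamily D d₀ d₀ := by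
  sorry

/-- **Stub F₃ (the constant family `N` is dominated, special fibre `n₀ = ([1,2], 1/(u(1+u)))`).** [folklore] -/
theorem frullani_dominated_N :
    ∀ (N : KZ.IntegralRep (1 + 1)), N.domain = KZlog.band {y : Fin 1 → ℝ | 0 < y 0 ∧ 2 * y 0 < 1} (fun _ => 1) (fun _ => 2) → (N.integrand = fun z => (z 1 * (1 + z 1))⁻¹) → ∃ n₀ : KZ.IntegralRep 1, n₀.domain = {x | 1 ≤ x 0 ∧ x 0 ≤ 2} ∧ (n₀.integrand = fun x => (x 0 * (1 + x 0))⁻¹) ∧ KZ.IsDominatedFamily N n₀ n₀ := by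
  sorry

/-- **Stub G (the special-fibre relation `1/v = 1/(1+v) + 1/(v(1+v))` on `[1,2]`).**
[Kontsevich–Zagier 2001, §1.2 rule (1)] [folklore] -/
theorem frullani_fibreRelation :
    ∀ (d₀ n₀ : KZ.IntegralRep 1), d₀.domain = {x | 1 ≤ x 0 ∧ x 0 ≤ 2} → (d₀.integrand = fun x => (x 0)⁻¹) → n₀.domain = {x | 1 ≤ x 0 ∧ x 0 ≤ 2} → (n₀.integrand = fun x => (x 0 * (1 + x 0))⁻¹) → ∃ r' : KZ.IntegralRep 1, r'.domain = {x | 1 ≤ x 0 ∧ x 0 ≤ 2} ∧ (r'.integrand = fun x => (1 + x 0)⁻¹) ∧ r'.IsRational ∧ KZ.of d₀ - KZ.of r' - KZ.of n₀ ∈ KZ.integrandAddRel := by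
  sorry

/-! ### Assembly: the Frullani pair satisfies the conclusion of `ParametricLifting` -/

/-- **The Frullani sector of `ParametricLifting`.** For `r = ((0,1], 1/((1+t)(1+2t)))` and
`r' = ([1,2], 1/(1+v))` (both of KZ's rational shape) there is a net of three DOMINATED families,
`G = [R₁] − [D] + [N] ∈ KZ.fibredRelations` — obtained from regularised linearity, the fibred dilation
`t ↦ 2t`, two fibre splits and the fibred blow-up `t = s v`, with `log(1/s)`-divergent intermediates
`A`, `B`, `B'`, `M` cancelling inside `G` — whose special fibres `r`, `d₀ = ([1,2], 1/v)`,
`n₀ = ([1,2], 1/(v(1+v)))` satisfy `[r] − [d₀] + [n₀] − ([r] − [r']) ∈ KZ.relations`. This is the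
conclusion of the crux `ParametricLifting` for the pair `(r, r')`, in the vocabulary
`KZ.IsDominatedFamily` / `KZ.fibredRelations` (definitionally its inlined clauses).
[Kontsevich–Zagier 2001, §1.2; Boros–Moll 2004, §5.6] [folklore] -/
theorem frullani_parametricLifting :
    ∃ (r r' : IntegralRep 1),
      r.domain = {x | 0 < x 0 ∧ x 0 ≤ 1} ∧ (r.integrand = fun x => ((1 + x 0) * (1 + 2 * x 0))⁻¹) ∧
      r'.domain = {x | 1 ≤ x 0 ∧ x 0 ≤ 2} ∧ (r'.integrand = fun x => (1 + x 0)⁻¹) ∧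
      r.IsRational ∧ r'.IsRational ∧
      ∃ (k : ℕ) (d : Fin k → ℕ) (m : Fin k → ℤ) (R : (i : Fin k) → IntegralRep (d i + 1))
        (r₀ g : (i : Fin k) → IntegralRep (d i)),
        (∀ i, IsDominatedFamily (R i) (r₀ i) (g i)) ∧
        (∑ i, m i • of (R i)) ∈ fibredRelations ∧
        (∑ i, m i • of (r₀ i)) - (of r - of r') ∈ relations := by
  -- the families
  obtain ⟨A₂, hA₂d, hA₂i⟩ := frullani_exists_bigRep
  obtain ⟨A, B', K, M, N, hAd, hAi, hB'd, hB'i, hKd, hKi, hMd, hMi, hNd, hNi, hsplit₁, hsplit₂⟩ :=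
    frullani_splits A₂ hA₂d hA₂i
  obtain ⟨R₁, B, hR₁d, hR₁i, hBd, hBi, hlin⟩ := frullani_exists_linearity A hAd hAi
  have hdil := frullani_dilation B B' hBd hBi hB'd hB'i
  obtain ⟨D, hDd, hDi, hblow⟩ := frullani_blowup K hKd hKi
  -- the special fibres
  obtain ⟨r, hrd, hri, hrat, hdomR⟩ := frullani_dominated_R R₁ hR₁d hR₁i
  obtain ⟨d₀, hd₀d, hd₀i, hdomD⟩ := frullani_dominated_D D hDd hDi
  obtain ⟨n₀, hn₀d, hn₀i, hdomN⟩ := frullani_dominated_N N hNd hNi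
  obtain ⟨r', hr'd, hr'i, hrat', hfib⟩ := frullani_fibreRelation d₀ n₀ hd₀d hd₀i hn₀d hn₀i
  refine ⟨r, r', hrd, hri, hr'd, hr'i, hrat, hrat', 3, fun _ => 1, ![1, -1, 1], ![R₁, D, N],
    ![r, d₀, n₀], ![r, d₀, n₀], ?_, ?_, ?_⟩
  · intro i
    fin_cases i
    · exact hdomR
    · exact hdomD
    · exact hdomN
  · -- the net `[R₁] − [D] + [N]` is a fibred relation
    have hnet : (∑ i : Fin 3, (![1, -1, 1] : Fin 3 → ℤ) i • of ((![R₁, D, N] : Fin 3 → IntegralRep (1 + 1)) i)) =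
        (of A - of K - of M) - (of A - of R₁ - of B) - (of B - of B') - (of B' - of M - of N)
          - (of D - of K) := by
      simp only [Fin.sum_univ_three, Matrix.cons_val_zero, Matrix.cons_val_one, Matrix.head_cons,
        Matrix.cons_val_two, Matrix.tail_cons, one_zsmul, neg_one_zsmul]
      abel
    rw [hnet]
    refine fibredRelations.sub_mem (fibredRelations.sub_mem (fibredRelations.sub_mem
      (fibredRelations.sub_mem hsplit₁ (mem_fibredRelations_of_mem_integrandAddRel hlin)) hdil) hsplit₂) hblow
  · -- the special-fibre relation
    have hsum : (∑ i : Fin 3, (![1, -1, 1] : Fin 3 → ℤ) i • of ((![r, d₀, n₀] : Fin 3 → IntegralRep 1) i)) -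
        (of r - of r') = -(of d₀ - of r' - of n₀) := by
      simp only [Fin.sum_univ_three, Matrix.cons_val_zero, Matrix.cons_val_one, Matrix.head_cons,
        Matrix.cons_val_two, Matrix.tail_cons, one_zsmul, neg_one_zsmul]
      abel
    rw [hsum]
    exact relations.neg_mem (integrandAddRel_subset_relations hfib)

/-- **The Frullani pair, literal shape.** The same statement with the clauses of the crux
`ParametricLifting` INLINED verbatim (the closure of the fibred generators and the three
domination / special-fibre clauses), i.e. literally the conclusion of
`Summit.KontsevichZagierPeriods.KontsevichZagierPeriods.Theses.ValuedFieldSpecialisation.ParametricLifting`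
at the pair `(r, r')`. [Kontsevich–Zagier 2001, §1.2] [folklore] -/
theorem frullani_parametricLifting_lit :
    ∃ (r r' : IntegralRep 1),
      r.domain = {x | 0 < x 0 ∧ x 0 ≤ 1} ∧ (r.integrand = fun x => ((1 + x 0) * (1 + 2 * x 0))⁻¹) ∧
      r'.domain = {x | 1 ≤ x 0 ∧ x 0 ≤ 2} ∧ (r'.integrand = fun x => (1 + x 0)⁻¹) ∧
      r.IsRational ∧ r'.IsRational ∧
      ∃ G ∈ AddSubgroup.closure (Literature.NumberTheory.Transcendental.KZ.domainAddRel ∪ Literature.NumberTheory.Transcendental.KZ.integrandAddRel ∪ {c | ∃ (n : ℕ) (r r' : Literature.NumberTheory.Transcendental.KZ.IntegralRep (n + 1)) (Φ : (Fin (n + 1) → ℝ) → (Fin (n + 1) → ℝ)) (Φ' : (Fin (n + 1) → ℝ) → (Fin (n + 1) → ℝ) →L[ℝ] (Fin (n + 1) → ℝ)), Literature.NumberTheory.Transcendental.IsSemialgebraicMapOn ℚ r.domain Φ ∧ (∀ x ∈ r.domain, HasFDerivWithinAt Φ (Φ' x) r.domain x) ∧ Set.InjOn Φ r.domain ∧ r'.domain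 = Φ '' r.domain ∧ (∀ x ∈ r.domain, r.integrand x = r'.integrand (Φ x) * |(Φ' x).det|) ∧ (∀ x ∈ r.domain, Φ x 0 = x 0) ∧ c = Literature.NumberTheory.Transcendental.KZ.of r - Literature.NumberTheory.Transcendental.KZ.of r'} ∪ {c | c ∈ Literature.NumberTheory.Transcendental.KZ.newtonLeibnizRel ∧ ∃ (n : ℕ) (r : Literature.NumberTheory.Transcendental.KZ.IntegralRep (n + 2)) (r' : Literature.NumberTheory.Transcendental.KZ.IntegralRep (n + 1)), c = Literature.NumberTheory.Transcendental.KZ.of r - Literature.NumberTheory.Transcendental.KZ.of r'}), (∃ (k : ℕ) (d : Fin k → ℕ) (m : Fin k → ℤ) (R : (i : Fin k) → Literature.NumberTheory.Transcendental.KZ.IntegralRep (d i + 1)) (r₀ g : (i : Fin k) → Literature.NumberTheory.Transcendental.KZ.IntegralRep (d i)), (∀ i, ((∃ ε > (0 : ℝ), ∀ z ∈ (R i).domain, 0 < z 0 → z 0 < ε → (fun i : Fin (d i) => z i.succ) ∈ (g i).domain ∧ |(R i).integrand z| ≤ (g i).integrand (fun i : Fin (d i) => z i.succ)) ∧ (∀ᵐ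 x : Fin (d i) → ℝ, ∀ᶠ s in nhdsWithin (0 : ℝ) (Set.Ioi 0), (Matrix.vecCons s x ∈ (R i).domain ↔ x ∈ (r₀ i).domain)) ∧ (∀ᵐ x : Fin (d i) → ℝ, x ∈ (r₀ i).domain → Filter.Tendsto (fun s : ℝ => (R i).integrand (Matrix.vecCons s x)) (nhdsWithin 0 (Set.Ioi 0)) (nhds ((r₀ i).integrand x))))) ∧ G = ∑ i, m i • Literature.NumberTheory.Transcendental.KZ.of (R i) ∧ (∑ i, m i • Literature.NumberTheory.Transcendental.KZ.of (r₀ i)) - (Literature.NumberTheory.Transcendental.KZ.of r - Literature.NumberTheory.Transcendental.KZ.of r') ∈ Literature.NumberTheory.Transcendental.KZ.relations) := by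
  obtain ⟨r, r', hrd, hri, hr'd, hr'i, hrat, hrat', k, d, m, R, r₀, g, hdom, hG, hfib⟩ :=
    frullani_parametricLifting
  exact ⟨r, r', hrd, hri, hr'd, hr'i, hrat, hrat', _, hG, k, d, m, R, r₀, g, hdom, rfl, hfib⟩

/-- **The Frullani identity `∫₀¹ dt/((1+t)(1+2t)) = ∫₁² dv/(1+v)` computed by regularisation.** The
values of the Frullani pair agree — not by evaluating either side (`log 3 − log 2`) but by the VALUE
SHADOW of the regularised net (`eval_specialFibre_eq_zero`: the special-fibre class of a dominated
fibred relation evaluates to `0`) and soundness of the moves. [Boros–Moll 2004, §5.6] [folklore] -/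
theorem frullani_value_eq :
    ∃ (r r' : IntegralRep 1),
      r.domain = {x | 0 < x 0 ∧ x 0 ≤ 1} ∧ (r.integrand = fun x => ((1 + x 0) * (1 + 2 * x 0))⁻¹) ∧
      r'.domain = {x | 1 ≤ x 0 ∧ x 0 ≤ 2} ∧ (r'.integrand = fun x => (1 + x 0)⁻¹) ∧
      r.value = r'.value := by
  obtain ⟨r, r', hrd, hri, hr'd, hr'i, -, -, k, d, m, R, r₀, g, hdom, hG, hfib⟩ :=
    frullani_parametricLifting
  refine ⟨r, r', hrd, hri, hr'd, hr'i, ?_⟩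
  have h0 : eval (∑ i, m i • of (r₀ i)) = 0 := eval_specialFibre_eq_zero m hdom hG
  have h1 : eval ((∑ i, m i • of (r₀ i)) - (of r - of r')) = 0 := relations_le_ker_eval_holds hfib
  rw [map_sub, h0, zero_sub, neg_eq_zero, map_sub, eval_of, eval_of, sub_eq_zero] at h1
  exact h1

end Summit.KontsevichZagierPeriods.ValuedFieldSpecialisation
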